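import Mathlib
import Literature.NumberTheory.LFunctions.Zhang2022.ToolkitGaussUnsmoothing
import Literature.NumberTheory.Sieve.ShiuUniform
import HarnessLib

/-!
# Toolkit: unsmoothing against Zhang's Gaussian weight — the input from Shiu's theorem

Topic `Literature/NumberTheory/LFunctions/Zhang2022` (Landau–Siegel audit tree; verdict-neutral).
Y. Zhang, *Discrete mean estimates and the Landau–Siegel zero*, arXiv:2211.02515v1 (2022)
[Zhang2022LandauSiegel] — **an unrefereed manuscript under adjudication**; this file is a GENERIC
analytic tool (nothing here is a claim of the manuscript, and nothing is asserted about its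
Theorems 1–2 or about Landau–Siegel zeros).

`ToolkitGaussUnsmoothing.lean` bounds the error of replacing a sharp sum `Σ_{n<X} a(n)/n` by the
smoothed sum `Σ_n a(n) n⁻¹ g(X/n)` (`g` = Zhang's (4.1), `GaussWeight.gWeight Λ`) in terms of a
SHORT-INTERVAL hypothesis `Σ_{x<n≤x+y} f(n) ≤ B y logᵏx` (`√x ≤ y ≤ x`) on a majorant `f ≥ |a|`.
This file supplies that hypothesis from Shiu's Brun–Titchmarsh theorem for multiplicative functions
in the form UNIFORM in `f` proved in the tree (`Literature.NumberTheory.Sieve.shiu_uniform`, modulus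
`q = 1`), and packages the result for the consumers "By (4.2) and (4.3), `Σ_{n<T} … =
Σ_n … g(T/n) + O(α₁)`" (§15 p.87, DAG `Z22:§15.u054`) and "… + `O(1/𝓛¹⁰)`" (§16 p.94, DAG
`Z22:§16.u040`):

* `shortInterval_of_multiplicative` — for `A₁ ≥ 0`, `A₂`, `k`, `C₁` there are `B ≥ 0`, `x₀ ≥ 3`
  such that EVERY nonnegative multiplicative `f` with `f(p^l) ≤ A₁^l`, `f(n) ≤ A₂(δ) n^δ` and
  `Σ_{p≤x} f(p)/p ≤ (k+1) log log x + C₁` (`x ≥ 3`) satisfies `Σ_{x<n≤x+y} f(n) ≤ B y logᵏx` for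
  `x ≥ x₀`, `√x ≤ y ≤ x`;
* `sum_Icc_le_of_rpow_bound` — the initial segment: `Σ_{1≤n≤x₀} f(n) ≤ A₂(1) x₀²`;
* `norm_sum_Ico_sub_tsum_mul_gWeight_le_of_multiplicative` — the packaged unsmoothing estimate:
  constants `C ≥ 0`, `X₀` depending only on `(A₁, A₂, k, C₁)` such that for every such `f`, every
  `a` with `|a| ≤ f`, every `X ≥ X₀` and `Λ` with `max(4, (k+1)/2) ≤ Λ ≤ X/e²`:
  `‖Σ_{1≤n<X} a(n)/n − Σ_n a(n) n⁻¹ g(X/n)‖ ≤ C logᵏX/√Λ`.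

## References

* Y. Zhang, arXiv:2211.02515v1 (2022), §4 (4.1)–(4.3) p.18; §15 p.87; §16 p.94.
  [cite: Zhang2022LandauSiegel, §4 (4.1)–(4.3)]
* P. Shiu, *A Brun–Titchmarsh theorem for multiplicative functions*, J. reine angew. Math. 313
  (1980) 161–170, Theorem 1. [cite: Shiu1980, Theorem 1]
-/

noncomputable section

open Real Finset

namespace Literature.NumberTheory.LFunctions.Zhang2022.GaussWeight

open Literature.NumberTheory.Sieve

/-- **Short-interval bound from Shiu's theorem, uniformly in the function.** For `A₁ ≥ 0`,
`A₂ : ℝ → ℝ`, `k : ℕ`, `C₁ : ℝ` there are `B ≥ 0` and `x₀ ≥ 3` such that every nonnegative `f`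
with `f(mn) = f(m)f(n)` for coprime `m, n`, `f(p^l) ≤ A₁^l`, `f(n) ≤ A₂(δ) n^δ` (`δ > 0`, `n ≥ 1`)
and `Σ_{p≤x prime} f(p)/p ≤ (k+1) log log x + C₁` (`x ≥ 3`) satisfies
`Σ_{x<n≤x+y} f(n) ≤ B y logᵏx` whenever `x ≥ x₀` and `√x ≤ y ≤ x` (Shiu's theorem with `q = 1`,
`ε = θ = 1/4`). [cite: Shiu1980, Theorem 1] -/
theorem shortInterval_of_multiplicative {A₁ : ℝ} (hA₁ : 0 ≤ A₁) (A₂ : ℝ → ℝ) (k : ℕ) (C₁ : ℝ) :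
    ∃ B x₀ : ℝ, 0 ≤ B ∧ 3 ≤ x₀ ∧ ∀ f : ℕ → ℝ, (∀ n, 0 ≤ f n) →
      (∀ m n : ℕ, m.Coprime n → f (m * n) = f m * f n) →
      (∀ p l : ℕ, p.Prime → 1 ≤ l → f (p ^ l) ≤ A₁ ^ l) →
      (∀ δ : ℝ, 0 < δ → ∀ n : ℕ, 1 ≤ n → f n ≤ A₂ δ * (n : ℝ) ^ δ) →
      (∀ x : ℝ, 3 ≤ x → ∑ p ∈ (Finset.Icc 1 ⌊x⌋₊).filter Nat.Prime, f p / p ≤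
          (k + 1) * Real.log (Real.log x) + C₁) →
      ∀ x y : ℝ, x₀ ≤ x → Real.sqrt x ≤ y → y ≤ x →
        ∑ n ∈ Finset.Ioc ⌊x⌋₊ ⌊x + y⌋₊, f n ≤ B * y * Real.log x ^ k := by
  obtain ⟨C, x₁, hC, h⟩ := shiu_uniform hA₁ A₂ (ε := 1 / 4) (θ := 1 / 4)
    (by norm_num) (by norm_num) (by norm_num) (by norm_num)
  refine ⟨C * Real.exp C₁, max x₁ 3, by positivity, le_max_right _ _, ?_⟩
  intro f hf0 hmul hA₁' hA₂' hprimes x y hx hy hyx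
  have hx3 : 3 ≤ x := le_trans (le_max_right _ _) hx
  have hx1 : x₁ ≤ x := le_trans (le_max_left _ _) hx
  have hx0 : 0 < x := by linarith
  have hlog3 : 1 < Real.log 3 := by
    rw [Real.lt_log_iff_exp_lt (by norm_num)]
    have := Real.exp_one_lt_d9; linarith
  have hlogx : 1 < Real.log x := lt_of_lt_of_le hlog3 (Real.log_le_log (by norm_num) hx3)
  have hlogx0 : 0 < Real.log x := by linarith
  -- the side conditions of Shiu's theorem with `ε = θ = 1/4`, `q = 1`, `a = 0`
  have hsqrt : Real.sqrt x = x ^ (1 / 2 : ℝ) := Real.sqrt_eq_rpow x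
  have hy' : x ^ (1 / 4 : ℝ) ≤ y := by
    refine le_trans ?_ hy
    rw [hsqrt]
    exact Real.rpow_le_rpow_of_exponent_le (by linarith) (by norm_num)
  have hy1 : 1 < y := by
    refine lt_of_lt_of_le ?_ hy
    rw [show (1 : ℝ) = Real.sqrt 1 by simp]
    exact Real.sqrt_lt_sqrt zero_le_one (by linarith)
  have hq : ((1 : ℕ) : ℝ) < y ^ (1 - 1 / 4 : ℝ) := by
    rw [Nat.cast_one]
    exact Real.one_lt_rpow hy1 (by norm_num)
  have hS := h f hf0 hmul hA₁' hA₂' x y hx1 hy' hyx 1 le_rfl hq 0 (Nat.coprime_one_right 0)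
  -- the left side contains the sum over `(⌊x⌋, ⌊x+y⌋]`
  haveI : Subsingleton (ZMod 1) := ZMod.subsingleton_iff.mpr rfl
  have hsub : Finset.Ioc ⌊x⌋₊ ⌊x + y⌋₊ ⊆ (Finset.Icc 1 ⌊x + y⌋₊).filter
      (fun n : ℕ => x < n ∧ (n : ZMod 1) = ((0 : ℕ) : ZMod 1)) := by
    intro n hn
    rw [Finset.mem_Ioc] at hn
    rw [Finset.mem_filter, Finset.mem_Icc]
    exact ⟨⟨by omega, hn.2⟩, (Nat.floor_lt hx0.le).mp hn.1, Subsingleton.elim _ _⟩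
  have hL : ∑ n ∈ Finset.Ioc ⌊x⌋₊ ⌊x + y⌋₊, f n ≤
      ∑ n ∈ (Finset.Icc 1 ⌊x + y⌋₊).filter
        (fun n : ℕ => x < n ∧ (n : ZMod 1) = ((0 : ℕ) : ZMod 1)), f n :=
    Finset.sum_le_sum_of_subset_of_nonneg hsub fun n _ _ => hf0 n
  -- the prime sum: `p ∤ 1` is automatic
  have hP : ∑ p ∈ (Finset.Icc 1 ⌊x⌋₊).filter (fun p : ℕ => p.Prime ∧ ¬p ∣ 1), f p / p ≤
      (k + 1) * Real.log (Real.log x) + C₁ := by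
    have hfc : (Finset.Icc 1 ⌊x⌋₊).filter (fun p : ℕ => p.Prime ∧ ¬p ∣ 1) =
        (Finset.Icc 1 ⌊x⌋₊).filter Nat.Prime :=
      Finset.filter_congr fun p _ =>
        ⟨fun hp => hp.1, fun hp => ⟨hp, fun h1 => hp.ne_one (Nat.dvd_one.mp h1)⟩⟩
    rw [hfc]
    exact hprimes x hx3
  have hexp : Real.exp (∑ p ∈ (Finset.Icc 1 ⌊x⌋₊).filter (fun p : ℕ => p.Prime ∧ ¬p ∣ 1),
      f p / p) ≤ Real.log x ^ (k + 1) * Real.exp C₁ := by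
    refine le_trans (Real.exp_le_exp.mpr hP) (le_of_eq ?_)
    rw [Real.exp_add]
    congr 1
    rw [show ((k : ℝ) + 1) = ((k + 1 : ℕ) : ℝ) by push_cast; ring, Real.exp_nat_mul,
      Real.exp_log hlogx0]
  -- assembly
  refine le_trans hL (le_trans hS ?_)
  rw [Nat.totient_one, Nat.cast_one, one_mul]
  calc C * y / Real.log x *
        Real.exp (∑ p ∈ (Finset.Icc 1 ⌊x⌋₊).filter (fun p : ℕ => p.Prime ∧ ¬p ∣ 1), f p / p)
      ≤ C * y / Real.log x * (Real.log x ^ (k + 1) * Real.exp C₁) :=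
        mul_le_mul_of_nonneg_left hexp (by positivity)
    _ = C * Real.exp C₁ * y * Real.log x ^ k := by
        rw [pow_succ]; field_simp

/-- **The initial segment**: if `f ≥ 0` and `f(n) ≤ A₂(δ) n^δ` for all `δ > 0`, `n ≥ 1`, then
`Σ_{1≤n≤x₀} f(n) ≤ A₂(1) x₀²` (`x₀ ≥ 0`). [folklore] -/
private theorem sum_Icc_le_of_rpow_bound {f : ℕ → ℝ} (hf0 : ∀ n, 0 ≤ f n) {A₂ : ℝ → ℝ}
    (hA₂ : ∀ δ : ℝ, 0 < δ → ∀ n : ℕ, 1 ≤ n → f n ≤ A₂ δ * (n : ℝ) ^ δ) {x₀ : ℝ} (hx₀ : 0 ≤ x₀) :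
    ∑ n ∈ Finset.Icc 1 ⌊x₀⌋₊, f n ≤ A₂ 1 * x₀ ^ 2 := by
  have hA1 : 0 ≤ A₂ 1 := by
    have h := hA₂ 1 one_pos 1 le_rfl
    simp only [Nat.cast_one, Real.one_rpow, mul_one] at h
    linarith [hf0 1]
  have hterm : ∀ n ∈ Finset.Icc 1 ⌊x₀⌋₊, f n ≤ A₂ 1 * x₀ := by
    intro n hn
    rw [Finset.mem_Icc] at hn
    have hnx : (n : ℝ) ≤ x₀ := (Nat.le_floor_iff hx₀).mp hn.2
    have h := hA₂ 1 one_pos n hn.1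
    rw [Real.rpow_one] at h
    exact le_trans h (mul_le_mul_of_nonneg_left hnx hA1)
  calc ∑ n ∈ Finset.Icc 1 ⌊x₀⌋₊, f n ≤ ∑ n ∈ Finset.Icc 1 ⌊x₀⌋₊, A₂ 1 * x₀ :=
        Finset.sum_le_sum hterm
    _ = (⌊x₀⌋₊ : ℝ) * (A₂ 1 * x₀) := by
        rw [Finset.sum_const, Nat.card_Icc, nsmul_eq_mul, Nat.add_sub_cancel]
    _ ≤ x₀ * (A₂ 1 * x₀) := mul_le_mul_of_nonneg_right (Nat.floor_le hx₀) (by positivity)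
    _ = A₂ 1 * x₀ ^ 2 := by ring

/-- **Unsmoothing against Zhang's weight `g` for coefficients with a multiplicative majorant**
(the packaged, uniform form of "By (4.2) and (4.3), `Σ_{n<X} a(n)/n = Σ_n a(n) n⁻¹ g(X/n) + O(…)`").
For `A₁ ≥ 0`, `A₂`, `k`, `C₁` there are `C ≥ 0` and `X₀` such that: for every nonnegative `f` with
`f(mn) = f(m)f(n)` (`(m,n) = 1`), `f(p^l) ≤ A₁^l`, `f(n) ≤ A₂(δ)n^δ`, `Σ_{p≤x} f(p)/p ≤
(k+1) log log x + C₁` (`x ≥ 3`), every `a : ℕ → ℂ` with `‖a(n)‖ ≤ f(n)` (`n ≥ 1`), and all `X ≥ X₀`,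
`Λ ≥ 4` with `k + 1 ≤ 2Λ` and `e²Λ ≤ X`: the smoothed series converges and
`‖Σ_{1≤n<X} a(n)/n − Σ_n a(n) n⁻¹ g_Λ(X/n)‖ ≤ C logᵏX / √Λ` (`g_Λ = GaussWeight.gWeight Λ`).
[cite: Zhang2022LandauSiegel, §4 (4.2)–(4.3); §15 p.87; §16 p.94] -/
theorem norm_sum_Ico_sub_tsum_mul_gWeight_le_of_multiplicative {A₁ : ℝ} (hA₁ : 0 ≤ A₁)
    (A₂ : ℝ → ℝ) (k : ℕ) (C₁ : ℝ) :
    ∃ C X₀ : ℝ, 0 ≤ C ∧ ∀ f : ℕ → ℝ, (∀ n, 0 ≤ f n) →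
      (∀ m n : ℕ, m.Coprime n → f (m * n) = f m * f n) →
      (∀ p l : ℕ, p.Prime → 1 ≤ l → f (p ^ l) ≤ A₁ ^ l) →
      (∀ δ : ℝ, 0 < δ → ∀ n : ℕ, 1 ≤ n → f n ≤ A₂ δ * (n : ℝ) ^ δ) →
      (∀ x : ℝ, 3 ≤ x → ∑ p ∈ (Finset.Icc 1 ⌊x⌋₊).filter Nat.Prime, f p / p ≤
          (k + 1) * Real.log (Real.log x) + C₁) →
      ∀ a : ℕ → ℂ, (∀ n : ℕ, 1 ≤ n → ‖a n‖ ≤ f n) →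
      ∀ X Λ : ℝ, X₀ ≤ X → 4 ≤ Λ → (k : ℝ) + 1 ≤ 2 * Λ → Real.exp 2 * Λ ≤ X →
        Summable (fun n : ℕ => a n / n * (gWeight Λ (X / n) : ℂ)) ∧
          ‖(∑ n ∈ Finset.Ico 1 ⌈X⌉₊, a n / n) - ∑' n : ℕ, a n / n * (gWeight Λ (X / n) : ℂ)‖ ≤
            C * Real.log X ^ k / Real.sqrt Λ := by
  obtain ⟨B, x₀, hB, hx₀3, hshort⟩ := shortInterval_of_multiplicative hA₁ A₂ k C₁
  set F : ℝ := max (A₂ 1 * x₀ ^ 2) 0 with hFdef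
  have hF : 0 ≤ F := le_max_right _ _
  refine ⟨3 ^ (k + 3) * (B + F) / 2, Real.exp 2 * x₀, by positivity, ?_⟩
  intro f hf0 hmul hA₁' hA₂' hprimes a haf X Λ hX hΛ hΛk hΛX
  have hx₀1 : 1 ≤ x₀ := by linarith
  have hShort := hshort f hf0 hmul hA₁' hA₂' hprimes
  have hSmall : ∑ n ∈ Finset.Icc 1 ⌊x₀⌋₊, f n ≤ F :=
    le_trans (sum_Icc_le_of_rpow_bound hf0 hA₂' (by linarith)) (le_max_left _ _)
  obtain ⟨hs, hle⟩ := norm_sum_Ico_sub_tsum_mul_gWeight_le_of_shortInterval hf0 haf hB hx₀1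
    hShort hSmall hF hΛ hΛk hX hΛX
  refine ⟨hs, le_trans hle ?_⟩
  -- `3^{k+3}(B logᵏX + F)/√Λ/2 ≤ 3^{k+3}(B+F)/2 · logᵏX/√Λ` since `log X ≥ 1`
  have he2 : (1 : ℝ) ≤ Real.exp 2 := Real.one_le_exp (by norm_num)
  have hX3 : Real.exp 2 * 3 ≤ X := le_trans (by nlinarith) hX
  have hX0 : 0 < X := by linarith
  have hlogX : 1 ≤ Real.log X := by
    rw [Real.le_log_iff_exp_le hX0]
    have : Real.exp 1 ≤ Real.exp 2 := Real.exp_le_exp.mpr (by norm_num)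
    linarith
  have hLk : 1 ≤ Real.log X ^ k := one_le_pow₀ hlogX
  have hsΛ : 0 < Real.sqrt Λ := Real.sqrt_pos.mpr (by linarith)
  have h3 : (0 : ℝ) ≤ 3 ^ (k + 3) := by positivity
  have hkey : B * Real.log X ^ k + F ≤ (B + F) * Real.log X ^ k := by
    rw [add_mul]
    have : F ≤ F * Real.log X ^ k := le_mul_of_one_le_right hF hLk
    linarith
  rw [div_div, div_le_div_iff₀ (by positivity) hsΛ]
  calc 3 ^ (k + 3) * (B * Real.log X ^ k + F) * Real.sqrt Λ
      ≤ 3 ^ (k + 3) * ((B + F) * Real.log X ^ k) * Real.sqrt Λ := by gcongr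
    _ = 3 ^ (k + 3) * (B + F) / 2 * Real.log X ^ k * (Real.sqrt Λ * 2) := by ring

end Literature.NumberTheory.LFunctions.Zhang2022.GaussWeight
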